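import Summits.NavierStokesRegularity.NavierStokesRegularity.Theses.AxisymmetricExtremality
import Summits.NavierStokesRegularity.NavierStokesRegularity.Theorems.AxisymmetricExtremalityAxisymmetricKatoGlobalStubSereginLogSwirlOriginStep3Balance
import HarnessLib

/-!
# Seregin 2022, §2 Step 3 for the LOCAL smooth class (IV): the weighted energy `∫(η³G)²`, its
# time derivative and the time-integrated localised energy inequality for a family `G` that is
# only continuous in time with an a.e.-in-`x` time derivative — crux stmt-NavierStokesRegularity-15453
# (`AxisymmetricExtremality.AxisymmetricKatoGlobal`), line registered, support for stub `stub_sereginLogSwirlOrigin`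

Support file (`--supports stmt-NavierStokesRegularity-15453`; theorems only, everything proved)
toward the registered stub `stub_sereginLogSwirlOrigin` = the named fact
`Literature.Analysis.FluidPDE.seregin2022_logSwirl_regularAtOrigin` (G. Seregin, J. Math. Fluid
Mech. 24 (2022), Paper 27 = arXiv:2201.00153, §2). The sibling `…Step3Balance` supplies the time
layer of Step 3 ("the key estimate can be derived by more or less standard arguments", arXiv
p. 7: `½∂ₜ∫(Gη³)²`, integration in time) for families `G` JOINTLY SMOOTH on `S × ℝ³` — the
regularity of `Γ = ω_θ/r`, `Φ = ω_r/r` along a whole-space classical solution. For the local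
Seregin–Zajaczkowski class (the smooth representative of a suitable weak solution near its regular
points: `C^∞` slices, spatial derivatives jointly continuous, NO time derivative of the velocity)
the vorticity is only `C¹` in time, and `Γ`, `Φ` have classical time derivatives off the axis
(`…Step3LocalClass`: `∂ₜΓ = ΔΓ + 2q_Γ − DΓ[u] − 2(u_θ/r)Φ` etc. for `cylRadius x ≠ 0`). This file
redoes the time layer at that regularity: `ζ = η³` jointly smooth and vanishing off a fixed
compact `K` as before, but `G` merely jointly CONTINUOUS on `S × ℝ³` together with a jointly
continuous `G'` which is the time derivative of `G(·, x)` for ALMOST EVERY `x` (the axis is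
Lebesgue-null):

* `hasDerivAt_integral_cutoff_sq_of_ae` — `d/dt ∫(ζG)² = 2∫ζ∂ₜζG² + 2∫ζ²GG'` (differentiation
  under the integral sign with an a.e. derivative hypothesis, Mathlib's
  `hasDerivAt_integral_of_dominated_loc_of_deriv_le`, dominated on `[t − δ, t + δ] × K` by the
  maximum of the continuous derivative density);
* `integral_cutoff_sq_sub_eq_of_ae` — the balance `E(t₂) − E(t₁) = ∫_{t₁}^{t₂}(…)` on
  `[t₁, t₂] ⊆ S` with a continuous density (`continuousOn_integral_of_support_subset`);
* `integral_cutoff_sq_add_le_of_forall_le_of_ae` (registered sub-goal) — **from the fixed-time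
  to the integrated localised energy inequality** at this regularity: if at every `t ∈ S`
  `∫ζ²GG' + ν∫|∇(ζG)|² ≤ ∫ζG²Dζ[b] + ν∫G²|∇ζ|² − 2ν∫ζG²q_ζ + ∫ζ²GR` (the shape of
  `integral_cutoff_energy_le`), with `G`, `D_xG`, `G'`, `b`, `R` jointly continuous, then for
  `[t₁, t₂] ⊆ S`
  `E(t₂) + 2ν∫_{t₁}^{t₂}∫|∇(ζG)|² ≤ E(t₁) + ∫_{t₁}^{t₂}[2∫ζ∂ₜζG² + 2∫ζG²Dζ[b] + 2ν∫G²|∇ζ|² − 4ν∫ζG²q_ζ + 2∫ζ²GR]`,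
  `E(t) = ∫(ζG)²(t)` — verbatim the conclusion of the smooth `integral_cutoff_sq_add_le_of_forall_le`.

## Mathlib / tree search

Tree: `hasDerivAt_integral_cutoff_sq`, `integral_cutoff_sq_sub_eq`,
`integral_cutoff_sq_add_le_of_forall_le`, `continuousOn_integral_cutoff` (`…Step3Balance`, the
jointly smooth versions), `continuousOn_integral_of_support_subset`,
`IsSmoothSpaceTimeOn.hasDerivAt_timeLine`, `timeDerivWithin_eq_deriv` (`SpaceTimeCalculus`),
`IsSmoothSpaceTimeOn.timeDerivWithin / .fderiv_slice / .radDerivQuot_family / .continuousOn`,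
`integrable_sq_mul_mul` (`…Step3CutoffCalculus`), `fderiv_eq_zero_of_forall_notMem`
(`…CutoffDivCurl`). Mathlib: `hasDerivAt_integral_of_dominated_loc_of_deriv_le`,
`IsCompact.exists_bound_of_continuousOn`, `IntegrableOn.integrable_indicator`,
`intervalIntegral.integral_eq_sub_of_hasDerivAt`, `intervalIntegral.integral_mono_on`.
`lean search 'cutoff_sq.*_of_ae|_of_ae_hasDerivAt' --decl`: no matches (2026-08-17).

## References

* G. Seregin, J. Math. Fluid Mech. 24 (2022), Paper No. 27 = arXiv:2201.00153, §2 Step 3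
  (arXiv pp. 6–7). [`Seregin2022LocalAxisym`]
-/

noncomputable section

open MeasureTheory Set Filter Topology Function intervalIntegral Metric
open scoped ENNReal ContDiff
open Literature.Analysis.FluidPDE

-- `<Problem> = <Summit>` duplicates a namespace component by design (lakefile sets the same option).
set_option linter.dupNamespace false

namespace Summit.NavierStokesRegularity.NavierStokesRegularity.Theorems.AxisymmetricKatoGlobal.EulerScaling

/-! ### Slices of jointly continuous families -/

section Slices

variable {Φ : ℝ → EuclideanSpace ℝ (Fin 3) → ℝ} {S : Set ℝ}

/-- A slice of a jointly continuous family is continuous. [folklore] -/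
theorem continuous_slice_of_continuousOn_uncurry (hΦ : ContinuousOn (uncurry Φ) (S ×ˢ univ))
    {s : ℝ} (hs : s ∈ S) : Continuous (Φ s) :=
  hΦ.comp_continuous (Continuous.prodMk_right s) fun x => ⟨hs, mem_univ x⟩

/-- A compact time-neighbourhood inside an open time set. [folklore] -/
theorem exists_Icc_subset_of_isOpen (hS : IsOpen S) {t : ℝ} (ht : t ∈ S) :
    ∃ δ > 0, Icc (t - δ) (t + δ) ⊆ S := by
  obtain ⟨r, hr, hrS⟩ := Metric.isOpen_iff.1 hS t ht
  refine ⟨r / 2, by positivity, fun s hs => hrS ?_⟩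
  rw [Metric.mem_ball, Real.dist_eq, abs_lt]
  constructor <;> linarith [hs.1, hs.2]

end Slices

/-! ### The weighted energy and its time derivative, a.e. time-differentiable data -/

section Balance

variable {S : Set ℝ} {ζ G G' : ℝ → EuclideanSpace ℝ (Fin 3) → ℝ} {K : Set (EuclideanSpace ℝ (Fin 3))}

/-- **The derivative of the weighted energy `∫(ζG)²`, for `G` continuous in time with an
a.e.-in-`x` time derivative.** Let `S` be open, `ζ` jointly smooth on `S × ℝ³` and vanishing
off a fixed compact `K`, and `G`, `G'` jointly continuous on `S × ℝ³` with
`d/ds G(s, x) = G'(s, x)` at every `s ∈ S` for almost every `x`. Then for `t ∈ S`,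
`d/dt ∫ (ζ t · G t)² = 2∫ ζ ∂ₜζ G² + 2∫ ζ² G G'` (`∂ₜζ = timeDerivWithin S ζ`). This is the
passage `∫ η⁶ G ∂ₜG = ½∂ₜ∫(η³G)² − ½∫G²∂ₜη⁶` of Seregin 2022, §2 Step 3, at the regularity of
the local class (the vorticity of the smooth representative is `C¹` in time, `Γ`, `Φ` are
differentiable in time off the Lebesgue-null axis). [cite: Seregin2022LocalAxisym, §2 Step 3 (arXiv:2201.00153 p. 6, the terms ½∂ₜ∫(Gη³)² and ½∫G²∂ₜη⁶)] -/
theorem hasDerivAt_integral_cutoff_sq_of_ae (hS : IsOpen S) (hζ : IsSmoothSpaceTimeOn S ζ)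
    (hK : IsCompact K) (hsupp : ∀ t ∈ S, ∀ x ∉ K, ζ t x = 0)
    (hG : ContinuousOn (uncurry G) (S ×ˢ univ)) (hG' : ContinuousOn (uncurry G') (S ×ˢ univ))
    (hder : ∀ᵐ x ∂(volume : Measure (EuclideanSpace ℝ (Fin 3))), ∀ s ∈ S,
      HasDerivAt (fun s' => G s' x) (G' s x) s)
    {t : ℝ} (ht : t ∈ S) :
    HasDerivAt (fun s => ∫ x, (ζ s x * G s x) ^ 2)
      (2 * (∫ x, ζ t x * timeDerivWithin S ζ t x * G t x ^ 2) +
        2 * ∫ x, ζ t x ^ 2 * G t x * G' t x) t := by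
  have hU : UniqueDiffOn ℝ S := hS.uniqueDiffOn
  obtain ⟨δ, hδ, hIcc⟩ := exists_Icc_subset_of_isOpen hS ht
  have hJS : Ioo (t - δ) (t + δ) ⊆ S := Ioo_subset_Icc_self.trans hIcc
  have hJn : Ioo (t - δ) (t + δ) ∈ 𝓝 t := Ioo_mem_nhds (by linarith) (by linarith)
  -- the data and their joint continuity
  have hζc : ContinuousOn (uncurry ζ) (S ×ˢ univ) := hζ.continuousOn
  have hζ'c : ContinuousOn (uncurry (timeDerivWithin S ζ)) (S ×ˢ univ) :=
    (hζ.timeDerivWithin hU).continuousOn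
  have hFc : ContinuousOn (fun z : ℝ × EuclideanSpace ℝ (Fin 3) =>
      (ζ z.1 z.2 * G z.1 z.2) * (ζ z.1 z.2 * G z.1 z.2)) (S ×ˢ univ) := (hζc.mul hG).mul (hζc.mul hG)
  have hF'c : ContinuousOn (fun z : ℝ × EuclideanSpace ℝ (Fin 3) =>
      2 * (ζ z.1 z.2 * timeDerivWithin S ζ z.1 z.2 * G z.1 z.2 ^ 2) +
        2 * (ζ z.1 z.2 ^ 2 * G z.1 z.2 * G' z.1 z.2)) (S ×ˢ univ) :=
    (continuousOn_const.mul ((hζc.mul hζ'c).mul (hG.pow 2))).add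
      (continuousOn_const.mul (((hζc.pow 2).mul hG).mul hG'))
  -- a uniform bound on `[t - δ, t + δ] × K`
  obtain ⟨B, hB⟩ := (isCompact_Icc.prod hK).exists_bound_of_continuousOn
    (hF'c.mono (prod_mono hIcc (subset_univ _)))
  have hmain := hasDerivAt_integral_of_dominated_loc_of_deriv_le
    (μ := (volume : Measure (EuclideanSpace ℝ (Fin 3))))
    (F := fun s x => (ζ s x * G s x) * (ζ s x * G s x))
    (F' := fun s x => 2 * (ζ s x * timeDerivWithin S ζ s x * G s x ^ 2) +
      2 * (ζ s x ^ 2 * G s x * G' s x))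
    (x₀ := t) (bound := K.indicator fun _ => B) hJn ?_ ?_ ?_ ?_ ?_ ?_
  · -- conclusion: split the integral of the derivative density
    have hfun : (fun s => ∫ x, (ζ s x * G s x) ^ 2) =
        fun s => ∫ x, (ζ s x * G s x) * (ζ s x * G s x) := by
      funext s
      exact integral_congr_ae (Eventually.of_forall fun x => by simp only; ring)
    rw [hfun]
    refine hmain.2.congr_deriv ?_
    have cζ : Continuous (ζ t) := (hζ.contDiff_slice ht).continuous
    have cζ' : Continuous (timeDerivWithin S ζ t) :=
      ((hζ.timeDerivWithin hU).contDiff_slice ht).continuous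
    have cG : Continuous (G t) := continuous_slice_of_continuousOn_uncurry hG ht
    have cG' : Continuous (G' t) := continuous_slice_of_continuousOn_uncurry hG' ht
    have hζcpt : HasCompactSupport (ζ t) := HasCompactSupport.intro hK (hsupp t ht)
    have i1 : Integrable (fun x => ζ t x * timeDerivWithin S ζ t x * G t x ^ 2) :=
      (((cζ.mul cζ').mul (cG.pow 2))).integrable_of_hasCompactSupport (hζcpt.mul_right).mul_right
    have i2 : Integrable (fun x => ζ t x ^ 2 * G t x * G' t x) :=
      integrable_sq_mul_mul cζ hζcpt cG cG'
    rw [integral_add (i1.const_mul 2) (i2.const_mul 2), MeasureTheory.integral_const_mul,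
      MeasureTheory.integral_const_mul]
  · -- measurability of the slices near `t`
    filter_upwards [hS.mem_nhds ht] with s hs
    exact (continuous_slice_of_continuousOn_uncurry
      (Φ := fun s x => (ζ s x * G s x) * (ζ s x * G s x)) hFc hs).aestronglyMeasurable
  · -- integrability at `t`
    have c := continuous_slice_of_continuousOn_uncurry
      (Φ := fun s x => (ζ s x * G s x) * (ζ s x * G s x)) hFc ht
    refine c.integrable_of_hasCompactSupport (HasCompactSupport.intro hK fun x hx => ?_)
    simp [hsupp t ht x hx]
  · exact (continuous_slice_of_continuousOn_uncurry (Φ := fun s x =>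
      2 * (ζ s x * timeDerivWithin S ζ s x * G s x ^ 2) + 2 * (ζ s x ^ 2 * G s x * G' s x))
      hF'c ht).aestronglyMeasurable
  · -- domination
    refine Eventually.of_forall fun x s hs => ?_
    by_cases hx : x ∈ K
    · rw [indicator_of_mem hx]
      exact hB (s, x) ⟨Ioo_subset_Icc_self hs, hx⟩
    · rw [indicator_of_notMem hx]
      simp [hsupp s (hJS hs) x hx]
  · exact (integrableOn_const (hK.measure_lt_top.ne)).integrable_indicator hK.measurableSet
  · -- the a.e. time derivative of the density
    filter_upwards [hder] with x hx s hs
    have hsS : s ∈ S := hJS hs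
    have hζd : HasDerivAt (fun s' => ζ s' x) (timeDerivWithin S ζ s x) s := by
      rw [timeDerivWithin_eq_deriv hS hsS ζ x]
      exact hζ.hasDerivAt_timeLine hS hsS x
    have h := ((hζd.mul (hx s hsS)).mul (hζd.mul (hx s hsS)))
    refine h.congr_deriv ?_
    simp only [Pi.mul_apply]
    ring

/-- **The weighted energy balance on a time interval**, a.e. time-differentiable data: under the
hypotheses of `hasDerivAt_integral_cutoff_sq_of_ae`, for `t₁ ≤ t₂` with `[t₁, t₂] ⊆ S`,
`∫ (ζG)²(t₂) − ∫ (ζG)²(t₁) = ∫_{t₁}^{t₂} (2∫ ζ∂ₜζ G² + 2∫ ζ²G G') dt`, the density being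
continuous on `S`. [cite: Seregin2022LocalAxisym, §2 Step 3 (arXiv:2201.00153 p. 7, integration in time of the key differential inequality)] -/
theorem integral_cutoff_sq_sub_eq_of_ae (hS : IsOpen S) (hζ : IsSmoothSpaceTimeOn S ζ)
    (hK : IsCompact K) (hsupp : ∀ t ∈ S, ∀ x ∉ K, ζ t x = 0)
    (hG : ContinuousOn (uncurry G) (S ×ˢ univ)) (hG' : ContinuousOn (uncurry G') (S ×ˢ univ))
    (hder : ∀ᵐ x ∂(volume : Measure (EuclideanSpace ℝ (Fin 3))), ∀ s ∈ S,
      HasDerivAt (fun s' => G s' x) (G' s x) s)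
    {t₁ t₂ : ℝ} (h12 : t₁ ≤ t₂) (hsub : Icc t₁ t₂ ⊆ S) :
    ContinuousOn (fun t => 2 * (∫ x, ζ t x * timeDerivWithin S ζ t x * G t x ^ 2) +
        2 * ∫ x, ζ t x ^ 2 * G t x * G' t x) S ∧
    (∫ x, (ζ t₂ x * G t₂ x) ^ 2) - ∫ x, (ζ t₁ x * G t₁ x) ^ 2 =
      ∫ t in t₁..t₂, (2 * (∫ x, ζ t x * timeDerivWithin S ζ t x * G t x ^ 2) +
        2 * ∫ x, ζ t x ^ 2 * G t x * G' t x) := by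
  have hU : UniqueDiffOn ℝ S := hS.uniqueDiffOn
  have hζc : ContinuousOn (uncurry ζ) (S ×ˢ univ) := hζ.continuousOn
  have hζ'c : ContinuousOn (uncurry (timeDerivWithin S ζ)) (S ×ˢ univ) :=
    (hζ.timeDerivWithin hU).continuousOn
  have c1 : ContinuousOn (fun t => ∫ x, ζ t x * timeDerivWithin S ζ t x * G t x ^ 2) S := by
    have hc : ContinuousOn (fun z : ℝ × EuclideanSpace ℝ (Fin 3) =>
        ζ z.1 z.2 * timeDerivWithin S ζ z.1 z.2 * G z.1 z.2 ^ 2) (S ×ˢ univ) :=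
      (hζc.mul hζ'c).mul (hG.pow 2)
    exact continuousOn_integral_cutoff (Ψ := fun t x => ζ t x * timeDerivWithin S ζ t x * G t x ^ 2)
      hK hc fun t ht x hx => by simp [hsupp t ht x hx]
  have c2 : ContinuousOn (fun t => ∫ x, ζ t x ^ 2 * G t x * G' t x) S := by
    have hc : ContinuousOn (fun z : ℝ × EuclideanSpace ℝ (Fin 3) =>
        ζ z.1 z.2 ^ 2 * G z.1 z.2 * G' z.1 z.2) (S ×ˢ univ) := ((hζc.pow 2).mul hG).mul hG'
    exact continuousOn_integral_cutoff (Ψ := fun t x => ζ t x ^ 2 * G t x * G' t x)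
      hK hc fun t ht x hx => by simp [hsupp t ht x hx]
  have hcont : ContinuousOn (fun t => 2 * (∫ x, ζ t x * timeDerivWithin S ζ t x * G t x ^ 2) +
      2 * ∫ x, ζ t x ^ 2 * G t x * G' t x) S :=
    (continuousOn_const.mul c1).add (continuousOn_const.mul c2)
  refine ⟨hcont, ?_⟩
  rw [intervalIntegral.integral_eq_sub_of_hasDerivAt]
  · intro t ht
    rw [uIcc_of_le h12] at ht
    exact hasDerivAt_integral_cutoff_sq_of_ae hS hζ hK hsupp hG hG' hder (hsub ht)
  · exact (hcont.mono hsub).intervalIntegrable_of_Icc h12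

end Balance

/-! ### From the fixed-time inequality to the integrated one, a.e. time-differentiable data -/

section Integrated

/-- **Integration in time of the localised energy inequality, for data continuous in time with
an a.e.-in-`x` time derivative** ("the key estimate can be derived by more or less standard
arguments", Seregin 2022, §2 Step 3, arXiv p. 7 — from the differential to the integrated form,
at the regularity of the local smooth class). Let `S` be an open interval, `ζ` jointly smooth on
`S × ℝ³` vanishing off a fixed compact `K` (`ζ = η³`), `G`, `G'`, `R` scalar and `b` vector
families jointly CONTINUOUS on `S × ℝ³`, the slices `G t` differentiable with `(t, x) ↦ D(G t)(x)`
jointly continuous, and `d/ds G(s, x) = G'(s, x)` on `S` for a.e. `x`. If at every `t ∈ S`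
`∫ ζ²G G' + ν∫|∇(ζG)|² ≤ ∫ ζG² Dζ[b] + ν∫ G²|∇ζ|² − 2ν∫ ζG² q_ζ + ∫ ζ²G R`
(`q_ζ = radDerivQuot ζ`; the shape of `integral_cutoff_energy_le`), then for `[t₁, t₂] ⊆ S`,
with `E(t) = ∫(ζG)²(t)`:
`E(t₂) + 2ν∫_{t₁}^{t₂}∫|∇(ζG)|² ≤ E(t₁) + ∫_{t₁}^{t₂}[2∫ζ∂ₜζG² + 2∫ζG²Dζ[b] + 2ν∫G²|∇ζ|² − 4ν∫ζG²q_ζ + 2∫ζ²GR]`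
— the conclusion of the jointly smooth `integral_cutoff_sq_add_le_of_forall_le`, verbatim.
Registered sub-goal toward `stub_sereginLogSwirlOrigin`. [cite: Seregin2022LocalAxisym, §2 Step 3 (arXiv:2201.00153 p. 7, "the key estimate can be derived by more or less standard arguments")] -/
theorem integral_cutoff_sq_add_le_of_forall_le_of_ae : ∀ (S : Set ℝ) (ν : ℝ) (ζ G G' R : ℝ → EuclideanSpace ℝ (Fin 3) → ℝ) (b : ℝ → EuclideanSpace ℝ (Fin 3) → EuclideanSpace ℝ (Fin 3)) (K : Set (EuclideanSpace ℝ (Fin 3))) (t₁ t₂ : ℝ), IsOpen S → Convex ℝ S → IsSmoothSpaceTimeOn S ζ → IsCompact K → (∀ t ∈ S, ∀ x ∉ K, ζ t x = 0) → ContinuousOn (uncurry G) (S ×ˢ univ) → ContinuousOn (uncurry G') (S ×ˢ univ) → (∀ᵐ x ∂(volume : Measure (EuclideanSpace ℝ (Fin 3))), ∀ s ∈ S, HasDerivAt (fun s' => G s' x) (G' s x) s) → (∀ t ∈ S, Differentiable ℝ (G t)) → ContinuousOn (fun z : ℝ × EuclideanSpace ℝ (Fin 3) => fderiv ℝ (G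 z.1) z.2) (S ×ˢ univ) → ContinuousOn (uncurry R) (S ×ˢ univ) → ContinuousOn (uncurry b) (S ×ˢ univ) → (∀ t ∈ S, (∫ x, ζ t x ^ 2 * G t x * G' t x) + ν * ∫ x, (fderiv ℝ (fun y => ζ t y * G t y) x (EuclideanSpace.single 0 1) ^ 2 + fderiv ℝ (fun y => ζ t y * G t y) x (EuclideanSpace.single 1 1) ^ 2 + fderiv ℝ (fun y => ζ t y * G t y) x (EuclideanSpace.single 2 1) ^ 2) ≤ (∫ x, ζ t x * G t x ^ 2 * fderiv ℝ (ζ t) x (b t x)) + ν * (∫ x, G t x ^ 2 * (fderiv ℝ (ζ t) x (EuclideanSpace.single 0 1) ^ 2 + fderiv ℝ (ζ t) x (EuclideanSpace.single 1 1) ^ 2 + fderiv ℝ (ζ t) x (EuclideanSpace.single 2 1) ^ 2)) - 2 * ν * (∫ x, ζ t x * G t x ^ 2 * radDerivQuot (ζ t) x) + ∫ x, ζ t x ^ 2 * G t x * R t x) → t₁ ≤ t₂ → Icc t₁ t₂ ⊆ S → (∫ x, (ζ t₂ x * G t₂ x) ^ 2) + 2 * ν * ∫ t in t₁..t₂, ∫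 x, (fderiv ℝ (fun y => ζ t y * G t y) x (EuclideanSpace.single 0 1) ^ 2 + fderiv ℝ (fun y => ζ t y * G t y) x (EuclideanSpace.single 1 1) ^ 2 + fderiv ℝ (fun y => ζ t y * G t y) x (EuclideanSpace.single 2 1) ^ 2) ≤ (∫ x, (ζ t₁ x * G t₁ x) ^ 2) + ∫ t in t₁..t₂, (2 * (∫ x, ζ t x * timeDerivWithin S ζ t x * G t x ^ 2) + 2 * (∫ x, ζ t x * G t x ^ 2 * fderiv ℝ (ζ t) x (b t x)) + 2 * ν * (∫ x, G t x ^ 2 * (fderiv ℝ (ζ t) x (EuclideanSpace.single 0 1) ^ 2 + fderiv ℝ (ζ t) x (EuclideanSpace.single 1 1) ^ 2 + fderiv ℝ (ζ t) x (EuclideanSpace.single 2 1) ^ 2)) - 4 * ν * (∫ x, ζ t x * G t x ^ 2 * radDerivQuot (ζ t) x) + 2 * ∫ x, ζ t x ^ 2 * G t x * R t x) := by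
  intro S ν ζ G G' R b K t₁ t₂ hS hc hζ hK hsupp hG hG' hder hGd hDG hR hb hfix h12 hsub
  have hU : UniqueDiffOn ℝ S := hS.uniqueDiffOn
  -- the generic balance
  obtain ⟨hdens, hbal⟩ := integral_cutoff_sq_sub_eq_of_ae hS hζ hK hsupp hG hG' hder h12 hsub
  -- joint continuity of the data built from `ζ`
  have hζc : ContinuousOn (uncurry ζ) (S ×ˢ univ) := hζ.continuousOn
  have hζ'c : ContinuousOn (uncurry (timeDerivWithin S ζ)) (S ×ˢ univ) :=
    (hζ.timeDerivWithin hU).continuousOn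
  have hDζ : ContinuousOn (uncurry fun t x => fderiv ℝ (ζ t) x) (S ×ˢ univ) :=
    (hζ.fderiv_slice hU).continuousOn
  have hζi : ∀ i : Fin 3, ContinuousOn (uncurry fun s x => fderiv ℝ (ζ s) x (EuclideanSpace.single i 1))
      (S ×ˢ univ) := fun i => (hζ.fderiv_slice_apply hU _).continuousOn
  have hqζ : ContinuousOn (uncurry fun s => radDerivQuot (ζ s)) (S ×ˢ univ) :=
    (hζ.radDerivQuot_family hc hU).continuousOn
  have hGi : ∀ i : Fin 3, ContinuousOn (fun z : ℝ × EuclideanSpace ℝ (Fin 3) =>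
      fderiv ℝ (G z.1) z.2 (EuclideanSpace.single i 1)) (S ×ˢ univ) := fun i =>
    hDG.clm_apply continuousOn_const
  have hζsd : ∀ t ∈ S, Differentiable ℝ (ζ t) := fun t ht =>
    (hζ.contDiff_slice ht).differentiable (by simp)
  -- `D(ζG) eᵢ = ζ DG eᵢ + G Dζ eᵢ` on `S × ℝ³`, jointly continuous
  have hDi : ∀ i : Fin 3, ContinuousOn (uncurry fun s x =>
      fderiv ℝ (fun y => ζ s y * G s y) x (EuclideanSpace.single i 1)) (S ×ˢ univ) := by
    intro i
    have h := (hζc.mul (hGi i)).add (hG.mul (hζi i))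
    refine h.congr fun z hz => ?_
    have hz1 : z.1 ∈ S := hz.1
    simp only [uncurry]
    exact fderiv_mul_apply_of_differentiableAt (hζsd z.1 hz1 z.2) (hGd z.1 hz1 z.2) _
  have hP0 : ∀ s ∈ S, ∀ x ∉ K, ζ s x * G s x = 0 := fun s hs x hx => by simp [hsupp s hs x hx]
  have cD : ContinuousOn (fun t => ∫ x,
      (fderiv ℝ (fun y => ζ t y * G t y) x (EuclideanSpace.single 0 1) ^ 2 +
        fderiv ℝ (fun y => ζ t y * G t y) x (EuclideanSpace.single 1 1) ^ 2 +
        fderiv ℝ (fun y => ζ t y * G t y) x (EuclideanSpace.single 2 1) ^ 2)) S := by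
    have h := (((hDi 0).pow 2).add ((hDi 1).pow 2)).add ((hDi 2).pow 2)
    refine continuousOn_integral_cutoff (Ψ := fun t x =>
      fderiv ℝ (fun y => ζ t y * G t y) x (EuclideanSpace.single 0 1) ^ 2 +
        fderiv ℝ (fun y => ζ t y * G t y) x (EuclideanSpace.single 1 1) ^ 2 +
        fderiv ℝ (fun y => ζ t y * G t y) x (EuclideanSpace.single 2 1) ^ 2) hK
      (h.congr fun z _ => by simp only [uncurry, Pi.add_apply, Pi.pow_apply]) fun t ht x hx => ?_
    have h0 : fderiv ℝ (fun y => ζ t y * G t y) x = 0 :=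
      fderiv_eq_zero_of_forall_notMem hK.isClosed (hP0 t ht) hx
    simp [h0]
  have c0 : ContinuousOn (fun t => ∫ x, ζ t x * timeDerivWithin S ζ t x * G t x ^ 2) S := by
    have h := (hζc.mul hζ'c).mul (hG.pow 2)
    exact continuousOn_integral_cutoff (Ψ := fun t x => ζ t x * timeDerivWithin S ζ t x * G t x ^ 2)
      hK (h.congr fun z _ => by simp only [uncurry, Pi.mul_apply, Pi.pow_apply])
      fun t ht x hx => by simp [hsupp t ht x hx]
  have c1 : ContinuousOn (fun t => ∫ x, ζ t x * G t x ^ 2 * fderiv ℝ (ζ t) x (b t x)) S := by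
    have h := (hζc.mul (hG.pow 2)).mul (hDζ.clm_apply hb)
    exact continuousOn_integral_cutoff (Ψ := fun t x => ζ t x * G t x ^ 2 * fderiv ℝ (ζ t) x (b t x))
      hK (h.congr fun z _ => by simp only [uncurry, Pi.mul_apply, Pi.pow_apply])
      fun t ht x hx => by simp [hsupp t ht x hx]
  have c2 : ContinuousOn (fun t => ∫ x, G t x ^ 2 *
      (fderiv ℝ (ζ t) x (EuclideanSpace.single 0 1) ^ 2 + fderiv ℝ (ζ t) x (EuclideanSpace.single 1 1) ^ 2 +
        fderiv ℝ (ζ t) x (EuclideanSpace.single 2 1) ^ 2)) S := by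
    have h := (hG.pow 2).mul (((((hζi 0).pow 2)).add ((hζi 1).pow 2)).add ((hζi 2).pow 2))
    refine continuousOn_integral_cutoff (Ψ := fun t x => G t x ^ 2 *
      (fderiv ℝ (ζ t) x (EuclideanSpace.single 0 1) ^ 2 + fderiv ℝ (ζ t) x (EuclideanSpace.single 1 1) ^ 2 +
        fderiv ℝ (ζ t) x (EuclideanSpace.single 2 1) ^ 2)) hK
      (h.congr fun z _ => by simp only [uncurry, Pi.mul_apply, Pi.pow_apply, Pi.add_apply])
      fun t ht x hx => ?_
    have h0 : fderiv ℝ (ζ t) x = 0 := fderiv_eq_zero_of_forall_notMem hK.isClosed (hsupp t ht) hx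
    simp [h0]
  have c3 : ContinuousOn (fun t => ∫ x, ζ t x * G t x ^ 2 * radDerivQuot (ζ t) x) S := by
    have h := (hζc.mul (hG.pow 2)).mul hqζ
    exact continuousOn_integral_cutoff (Ψ := fun t x => ζ t x * G t x ^ 2 * radDerivQuot (ζ t) x)
      hK (h.congr fun z _ => by simp only [uncurry, Pi.mul_apply, Pi.pow_apply])
      fun t ht x hx => by simp [hsupp t ht x hx]
  have c4 : ContinuousOn (fun t => ∫ x, ζ t x ^ 2 * G t x * R t x) S := by
    have h := ((hζc.pow 2).mul hG).mul hR
    exact continuousOn_integral_cutoff (Ψ := fun t x => ζ t x ^ 2 * G t x * R t x)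
      hK (h.congr fun z _ => by simp only [uncurry, Pi.mul_apply, Pi.pow_apply])
      fun t ht x hx => by simp [hsupp t ht x hx]
  -- the pointwise-in-time inequality
  have hpt : ∀ t ∈ Icc t₁ t₂,
      (2 * (∫ x, ζ t x * timeDerivWithin S ζ t x * G t x ^ 2) +
        2 * ∫ x, ζ t x ^ 2 * G t x * G' t x) +
      2 * ν * (∫ x,
        (fderiv ℝ (fun y => ζ t y * G t y) x (EuclideanSpace.single 0 1) ^ 2 +
          fderiv ℝ (fun y => ζ t y * G t y) x (EuclideanSpace.single 1 1) ^ 2 +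
          fderiv ℝ (fun y => ζ t y * G t y) x (EuclideanSpace.single 2 1) ^ 2)) ≤
      2 * (∫ x, ζ t x * timeDerivWithin S ζ t x * G t x ^ 2) +
        2 * (∫ x, ζ t x * G t x ^ 2 * fderiv ℝ (ζ t) x (b t x)) +
        2 * ν * (∫ x, G t x ^ 2 * (fderiv ℝ (ζ t) x (EuclideanSpace.single 0 1) ^ 2 +
          fderiv ℝ (ζ t) x (EuclideanSpace.single 1 1) ^ 2 +
          fderiv ℝ (ζ t) x (EuclideanSpace.single 2 1) ^ 2)) -
        4 * ν * (∫ x, ζ t x * G t x ^ 2 * radDerivQuot (ζ t) x) +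
        2 * ∫ x, ζ t x ^ 2 * G t x * R t x := by
    intro t ht12
    nlinarith [hfix t (hsub ht12)]
  -- integrate in time
  have hIdens := (hdens.mono hsub).intervalIntegrable_of_Icc (μ := volume) h12
  have hID := (cD.mono hsub).intervalIntegrable_of_Icc (μ := volume) h12
  have hIF : IntervalIntegrable (fun t =>
      2 * (∫ x, ζ t x * timeDerivWithin S ζ t x * G t x ^ 2) +
        2 * (∫ x, ζ t x * G t x ^ 2 * fderiv ℝ (ζ t) x (b t x)) +
        2 * ν * (∫ x, G t x ^ 2 * (fderiv ℝ (ζ t) x (EuclideanSpace.single 0 1) ^ 2 +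
          fderiv ℝ (ζ t) x (EuclideanSpace.single 1 1) ^ 2 +
          fderiv ℝ (ζ t) x (EuclideanSpace.single 2 1) ^ 2)) -
        4 * ν * (∫ x, ζ t x * G t x ^ 2 * radDerivQuot (ζ t) x) +
        2 * ∫ x, ζ t x ^ 2 * G t x * R t x) volume t₁ t₂ := by
    refine (ContinuousOn.mono ?_ hsub).intervalIntegrable_of_Icc h12
    exact ((((continuousOn_const.mul c0).add (continuousOn_const.mul c1)).add
      (continuousOn_const.mul c2)).sub (continuousOn_const.mul c3)).add (continuousOn_const.mul c4)
  have hmono := intervalIntegral.integral_mono_on h12 (hIdens.add (hID.const_mul (2 * ν))) hIF hpt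
  rw [intervalIntegral.integral_add hIdens (hID.const_mul (2 * ν)),
    intervalIntegral.integral_const_mul] at hmono
  linarith [hbal, hmono]

end Integrated

end Summit.NavierStokesRegularity.NavierStokesRegularity.Theorems.AxisymmetricKatoGlobal.EulerScaling

end
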